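import Summits.Schanuel.Schanuel.Theorems.RootDecomp1KNW96Gap02

/-!
# RootDecomp1KNW96Gap02 — lens 6, generation 22 ADDENDUM «NW96-THM1 GAP — second kernel» (critic NOTE L2130: owed CHECKLIST G22 bookkeeping delivered; AUDIT ×1 of record stands, no new count): §A checklist shapes with `D : ℕ` and labels in `ℤ × ℤ` (`box_lt_L_nat`, `nw1996_lemma6_asPrinted_false_int`), §B the width count of step c) — printed (non-negative s) versus proved (signed s) range (`printed_bound_of_nonneg`, `signed_width_exceeds_printed`), §C the SCOPE of the gap typed (`NW1996MainNonreal`, `NW1996MainRH` — Literature target texts) with the PROVED transfer `NW1996MainRH 2 c → NW1996MainR ((127/60)·c)` — continuation (RootDecomp1KNW96Gap03): §C scope of the gap, typed + the A ↦ A² transfer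

(lens-6 g22 HOME addendum NW96Gap2.lean 388f7889…, 448 l, imports the TREE port RootDecomp1KNW96Gap + Mathlib ExponentialBounds, same namespace; ADDENDUM L2119 / RESULT L2120, writer re-check L2126, critic NOTE L2130 (BOOKED, PORT GO LOW as RootDecomp1KNW96Gap02 `--supports stmt-Schanuel-33364`; the two typed-target defs to be placed in Literature like `NW1996MainR`); port by census-1 gen 18 as `RootDecomp1KNW96Gap02`–`03`: 02 = §A + §B, 03 = §C. PORT EDITS: `set_option linter.dupNamespace false` dropped; three one-line docstrings added; `def NW1996MainNonreal` / `def NW1996MainRH` MOVED to Literature/NumberTheory/Transcendental/ExpLogSimultaneousApproximationMeasure.lean (census ONE-file append p829657, next to `NW1996MainR`) and referenced through `open Literature.NumberTheory.Transcendental`; statements and proofs otherwise verbatim. No census credit carried; rung 0; nothing here asserts any constant for NW96 Thm 1.)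
-/

namespace Summit.Schanuel.Schanuel.Theorems.RootDecomp1KNW96Gap

open Literature.NumberTheory.Transcendental

/-! ## §C  Scope of the gap, typed: non-real fields; the `h(α) ≤ ½ log A` regime; `A ↦ A²` -/

/-- Read-back: `κ = 1` is the registered shape (up to `1 * h = h`). -/
theorem mainRH_one_iff_mainR (c : ℝ) : NW1996MainRH 1 c ↔ NW1996MainR c := by
  unfold NW1996MainRH NW1996MainR
  simp only [one_mul]

/-- Hence `NW1996MainRH 1 211 ↔` the registered fact. -/
theorem mainRH_one_211_iff_thm_1 : NW1996MainRH 1 211 ↔ NesterenkoWaldschmidt1996_thm_1 :=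
  (mainRH_one_iff_mainR 211).trans thm_1_iff_mainR.symm

/-- The full statement restricts to non-real fields (trivially). -/
theorem mainNonreal_of_mainR {c : ℝ} (h : NW1996MainR c) : NW1996MainNonreal c := by
  intro θ α β A B E hθ hα hβ hαa hβa _ hA hB hE hAh hBh
  exact h θ α β A B E hθ hα hβ hαa hβa hA hB hE hAh hBh

/-- In particular the registered fact gives `NW1996MainNonreal 211`. -/
theorem mainNonreal_211_of_thm_1 (h : NesterenkoWaldschmidt1996_thm_1) : NW1996MainNonreal 211 :=
  mainNonreal_of_mainR (thm_1_iff_mainR.mp h)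

/-- Monotonicity in `κ`: a larger `κ ≥ 0`... no — a SMALLER `κ'≤ κ` weakens the hypothesis on `A`, so
`NW1996MainRH κ' c → NW1996MainRH κ c` for `κ' ≤ κ` (heights are `≥ 0`). -/
theorem NW1996MainRH.mono_kappa {κ κ' c : ℝ} (hκ : κ' ≤ κ) (h : NW1996MainRH κ' c) : NW1996MainRH κ c := by
  intro θ α β A B E hθ hα hβ hαa hβa hA hB hE hAh hBh
  refine h θ α β A B E hθ hα hβ hαa hβa hA hB hE ?_ hBh
  haveI : FiniteDimensional ℚ (IntermediateField.adjoin ℚ ({α, β} : Set ℂ)) := by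
    refine IntermediateField.finiteDimensional_adjoin (fun x hx => ?_)
    simp only [Set.mem_insert_iff, Set.mem_singleton_iff] at hx
    rcases hx with rfl | rfl
    · exact isAlgebraic_iff_isIntegral.mp hαa
    · exact isAlgebraic_iff_isIntegral.mp hβa
  have hh : 0 ≤ weilHeight₁ (IntermediateField.adjoin ℚ ({α, β} : Set ℂ)) (fun _ : Unit => α) :=
    weilHeight₁_nonneg _ _
  refine max_le ?_ (le_trans (le_max_right _ _) hAh)
  exact le_trans (mul_le_mul_of_nonneg_right hκ hh) (le_trans (le_max_left _ _) hAh)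

/-- In particular `NW1996MainR c → NW1996MainRH 2 c`. -/
theorem mainRH_two_of_mainR {c : ℝ} (h : NW1996MainR c) : NW1996MainRH 2 c :=
  NW1996MainRH.mono_kappa (by norm_num) ((mainRH_one_iff_mainR c).mpr h)

/-- The real-variable inequality behind the `A ↦ A²` transfer: with `W = lB + llA + 4lD + 2lEθ + 10 ≥ 12`,
`W₂ = W + log 2 ≤ (127/120)·W`, `V₂ = 2D·lA + 2E·nθ + 6lE ≤ 2V`, one gets `c·D·W₂·V₂·U ≤ (127/60)c·D·W·V·U`. -/
theorem transfer_ineq {c c' D lB llA lD lEθ lA lE E nθ lD2 : ℝ} (hc : 0 ≤ c) (hc' : 127 / 60 * c ≤ c')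
    (hD : 0 < D) (hlB : 0 ≤ lB) (hllA : -lD ≤ llA) (hlD : 0 ≤ lD) (hlEθ : 1 ≤ lEθ) (hlA : 0 < lA)
    (hlE : 1 ≤ lE) (hE : 0 < E) (hnθ : 0 ≤ nθ) (hlD2 : 0 ≤ lD2) :
    c * D * (lB + (Real.log 2 + llA) + 4 * lD + 2 * lEθ + 10) * (D * (2 * lA) + 2 * E * nθ + 6 * lE) *
        ((33 / 10 : ℝ) * D * lD2 + lE) / lE ^ 2 ≤
      c' * D * (lB + llA + 4 * lD + 2 * lEθ + 10) * (D * lA + 2 * E * nθ + 6 * lE) *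
        ((33 / 10 : ℝ) * D * lD2 + lE) / lE ^ 2 := by
  have hlog2 : Real.log 2 ≤ 7 / 10 := by have := Real.log_two_lt_d9; linarith
  have hlog2' : 0 ≤ Real.log 2 := Real.log_nonneg (by norm_num)
  have hDlA : 0 < D * lA := mul_pos hD hlA
  have hEn : 0 ≤ E * nθ := mul_nonneg hE.le hnθ
  have hU : 0 ≤ (33 / 10 : ℝ) * D * lD2 + lE := by
    have : 0 ≤ D * lD2 := mul_nonneg hD.le hlD2
    linarith
  have hW12 : 12 ≤ lB + llA + 4 * lD + 2 * lEθ + 10 := by linarith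
  have hW2 : lB + (Real.log 2 + llA) + 4 * lD + 2 * lEθ + 10 ≤ 127 / 120 * (lB + llA + 4 * lD + 2 * lEθ + 10) := by
    linarith
  have hV2 : D * (2 * lA) + 2 * E * nθ + 6 * lE ≤ 2 * (D * lA + 2 * E * nθ + 6 * lE) := by linarith
  have hV20 : 0 ≤ D * (2 * lA) + 2 * E * nθ + 6 * lE := by linarith
  have hW0 : 0 ≤ 127 / 120 * (lB + llA + 4 * lD + 2 * lEθ + 10) := by linarith
  have hprod : (lB + (Real.log 2 + llA) + 4 * lD + 2 * lEθ + 10) * (D * (2 * lA) + 2 * E * nθ + 6 * lE) ≤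
      127 / 60 * ((lB + llA + 4 * lD + 2 * lEθ + 10) * (D * lA + 2 * E * nθ + 6 * lE)) := by
    calc (lB + (Real.log 2 + llA) + 4 * lD + 2 * lEθ + 10) * (D * (2 * lA) + 2 * E * nθ + 6 * lE)
        ≤ (127 / 120 * (lB + llA + 4 * lD + 2 * lEθ + 10)) * (2 * (D * lA + 2 * E * nθ + 6 * lE)) :=
          mul_le_mul hW2 hV2 hV20 hW0
      _ = 127 / 60 * ((lB + llA + 4 * lD + 2 * lEθ + 10) * (D * lA + 2 * E * nθ + 6 * lE)) := by ring
  have hlE2 : 0 ≤ lE ^ 2 := sq_nonneg _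
  apply div_le_div_of_nonneg_right _ hlE2
  have hcDU : 0 ≤ c * D * ((33 / 10 : ℝ) * D * lD2 + lE) := by
    have : 0 ≤ c * D := mul_nonneg hc hD.le
    exact mul_nonneg this hU
  have hWVU : 0 ≤ D * ((lB + llA + 4 * lD + 2 * lEθ + 10) * (D * lA + 2 * E * nθ + 6 * lE)) *
      ((33 / 10 : ℝ) * D * lD2 + lE) := by
    have h1 : 0 ≤ (lB + llA + 4 * lD + 2 * lEθ + 10) * (D * lA + 2 * E * nθ + 6 * lE) :=
      mul_nonneg (by linarith) (by linarith)
    exact mul_nonneg (mul_nonneg hD.le h1) hU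
  calc c * D * (lB + (Real.log 2 + llA) + 4 * lD + 2 * lEθ + 10) * (D * (2 * lA) + 2 * E * nθ + 6 * lE) *
        ((33 / 10 : ℝ) * D * lD2 + lE)
      = (c * D * ((33 / 10 : ℝ) * D * lD2 + lE)) *
          ((lB + (Real.log 2 + llA) + 4 * lD + 2 * lEθ + 10) * (D * (2 * lA) + 2 * E * nθ + 6 * lE)) := by ring
    _ ≤ (c * D * ((33 / 10 : ℝ) * D * lD2 + lE)) *
          (127 / 60 * ((lB + llA + 4 * lD + 2 * lEθ + 10) * (D * lA + 2 * E * nθ + 6 * lE))) :=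
        mul_le_mul_of_nonneg_left hprod hcDU
    _ = (127 / 60 * c) * (D * ((lB + llA + 4 * lD + 2 * lEθ + 10) * (D * lA + 2 * E * nθ + 6 * lE)) *
          ((33 / 10 : ℝ) * D * lD2 + lE)) := by ring
    _ ≤ c' * (D * ((lB + llA + 4 * lD + 2 * lEθ + 10) * (D * lA + 2 * E * nθ + 6 * lE)) *
          ((33 / 10 : ℝ) * D * lD2 + lE)) := mul_le_mul_of_nonneg_right hc' hWVU
    _ = c' * D * (lB + llA + 4 * lD + 2 * lEθ + 10) * (D * lA + 2 * E * nθ + 6 * lE) *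
          ((33 / 10 : ℝ) * D * lD2 + lE) := by ring

/-- **`A ↦ A²` transfer.**  The `κ = 2` statement (what the printed argument proves for all fields) implies the registered
SHAPE for every constant `c' ≥ (127/60)·c` (`2·(1 + 0.7/12)`): apply it with `A²` in place of `A`
(`log A² = 2 log A ≥ max(2h(α), 1/D)`), and absorb `log log A² = log 2 + log log A ≤ log log A + 0.7`,
`0.7 ≤ (0.7/12)·W log E` (`W log E ≥ 12`), `D log A² + 2E|θ| + 6 log E ≤ 2 V log E` (`transfer_ineq`).  So
`NW1996MainRH 2 211` already gives every `hNW` consumer `NW1996MainR 447` (`(127/60)·211 = 446.61…`). -/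
theorem mainR_of_mainRH_two {c c' : ℝ} (hc : 0 ≤ c) (hc' : 127 / 60 * c ≤ c') (h : NW1996MainRH 2 c) :
    NW1996MainR c' := by
  intro θ α β A B E hθ hα hβ hαa hβa hA hB hE hAh hBh
  haveI : FiniteDimensional ℚ (IntermediateField.adjoin ℚ ({α, β} : Set ℂ)) := by
    refine IntermediateField.finiteDimensional_adjoin (fun x hx => ?_)
    simp only [Set.mem_insert_iff, Set.mem_singleton_iff] at hx
    rcases hx with rfl | rfl
    · exact isAlgebraic_iff_isIntegral.mp hαa
    · exact isAlgebraic_iff_isIntegral.mp hβa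
  have hDpos : 0 < Module.finrank ℚ (IntermediateField.adjoin ℚ ({α, β} : Set ℂ)) := Module.finrank_pos
  have hD1 : (1 : ℝ) ≤ (Module.finrank ℚ (IntermediateField.adjoin ℚ ({α, β} : Set ℂ)) : ℝ) := by
    exact_mod_cast hDpos
  have hD0 : (0 : ℝ) < (Module.finrank ℚ (IntermediateField.adjoin ℚ ({α, β} : Set ℂ)) : ℝ) := by linarith
  have hhα : 0 ≤ weilHeight₁ (IntermediateField.adjoin ℚ ({α, β} : Set ℂ)) (fun _ : Unit => α) :=
    weilHeight₁_nonneg _ _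
  have hhβ : 0 ≤ weilHeight₁ (IntermediateField.adjoin ℚ ({α, β} : Set ℂ)) (fun _ : Unit => β) :=
    weilHeight₁_nonneg _ _
  have hlogE : 1 ≤ Real.log E := by
    rw [← Real.log_exp 1]; exact Real.log_le_log (Real.exp_pos 1) hE
  have hE0 : 0 < E := lt_of_lt_of_le (Real.exp_pos 1) hE
  have hinvD : 1 / (Module.finrank ℚ (IntermediateField.adjoin ℚ ({α, β} : Set ℂ)) : ℝ) ≤ Real.log A :=
    le_trans (le_max_right _ _) hAh
  have hinvD0 : 0 < 1 / (Module.finrank ℚ (IntermediateField.adjoin ℚ ({α, β} : Set ℂ)) : ℝ) := by positivity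
  have hlogA : 0 < Real.log A := lt_of_lt_of_le hinvD0 hinvD
  have hhαA : weilHeight₁ (IntermediateField.adjoin ℚ ({α, β} : Set ℂ)) (fun _ : Unit => α) ≤ Real.log A :=
    le_trans (le_max_left _ _) hAh
  have hlogB : 0 ≤ Real.log B := le_trans hhβ hBh
  have hA2 : 0 < A ^ 2 := by positivity
  have hlogA2 : Real.log (A ^ 2) = 2 * Real.log A := by
    rw [Real.log_pow]; norm_num
  have hAh2 : max (2 * weilHeight₁ (IntermediateField.adjoin ℚ ({α, β} : Set ℂ)) (fun _ : Unit => α))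
      (1 / (Module.finrank ℚ (IntermediateField.adjoin ℚ ({α, β} : Set ℂ)) : ℝ)) ≤ Real.log (A ^ 2) := by
    rw [hlogA2]
    exact max_le (by linarith) (by linarith)
  have h2 := h θ α β (A ^ 2) B E hθ hα hβ hαa hβa hA2 hB hE hAh2 hBh
  refine le_trans ?_ h2
  rw [Real.exp_le_exp, neg_le_neg_iff, hlogA2, Real.log_mul (by norm_num) hlogA.ne']
  have hlD0 : 0 ≤ Real.log (Module.finrank ℚ (IntermediateField.adjoin ℚ ({α, β} : Set ℂ)) : ℝ) :=
    Real.log_nonneg hD1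
  have hllA : -Real.log (Module.finrank ℚ (IntermediateField.adjoin ℚ ({α, β} : Set ℂ)) : ℝ) ≤
      Real.log (Real.log A) := by
    have := Real.log_le_log hinvD0 hinvD
    rw [one_div, Real.log_inv] at this
    exact this
  have hlEθ : 1 ≤ Real.log (E * max 1 ‖θ‖) := by
    have h1 : E ≤ E * max 1 ‖θ‖ := le_mul_of_one_le_right hE0.le (le_max_left _ _)
    exact le_trans hlogE (Real.log_le_log hE0 h1)
  have hlD2 : 0 ≤ Real.log ((Module.finrank ℚ (IntermediateField.adjoin ℚ ({α, β} : Set ℂ)) : ℝ) + 2) :=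
    Real.log_nonneg (by linarith)
  exact transfer_ineq hc hc' hD0 hlogB hllA hlD0 hlEθ hlogA hlogE hE0 (norm_nonneg θ) hlD2

/-- Corollary: what the printed argument proves for all fields (`NW1996MainRH 2 211`) already yields the registered SHAPE
with constant `447`. -/
theorem mainR_447_of_mainRH_two_211 (h : NW1996MainRH 2 211) : NW1996MainR 447 :=
  mainR_of_mainRH_two (by norm_num) (by norm_num) h

end Summit.Schanuel.Schanuel.Theorems.RootDecomp1KNW96Gap
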